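import Summits.Ventures.PercRepro.Night2NearFatStructure
import Summits.Ventures.PercRepro.Night2NearFatCells

/-!
# night-2: THE NON-THREE-PLANAR CASE AT `N = 10, 9, 8` — the basis pairs (gen 40)

The long-line structure of a basis pair (Night2NearFatStructure) against the cells (Night2NearFatCells):
* **`basis_pair_fair_ntp_ten`** (`|W| = 10`, every basis line with `≤ 6` points of `W`, every line through a basis point
  with `≤ 8`): the long basis lines carry `5` or `6` points and are disjoint, a long class has `6 … 8` points, two long
  classes cannot coexist (`6 + 6 − 1 > 10`), a `6`-line and an `8`-class cannot coexist (`6 + 8 − 1 > 10`): the cells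
  `(0,0,8,0)`, `(5,0,8,0)`, `(5,5,8,0)`, `(6,0,7,0)` and their mirrors;
* **`basis_pair_fair_ntp_nine`** (`|W| = 9`, basis lines `≤ 4`, classes `≤ 6`): the cells `(0,0,6,6)`, `(4,0,6,6)`,
  `(4,4,6,6)`;
* **`basis_pair_fair_ntp_eight`** (`|W| = 8`, basis lines `≤ 3`, classes `≤ 6`): the cell `(0,0,6,0)`.
Paper: proofs/NIGHT-2-g40.md §5.
-/

namespace PercRepro.Shadow

open PercRepro.ThmH PercRepro.PerFlat

variable {α : Type*} [DecidableEq α] {M : Matroid α} [M.Finite] {G : Finset α}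

/-- The arithmetic of the `N = 10` cells. -/
theorem one_le_ntpIncome_ten_of (d₁ d₂ e : ℕ) (h₁ : d₁ = 0 ∨ (5 ≤ d₁ ∧ d₁ ≤ 6)) (h₂ : d₂ = 0 ∨ (5 ≤ d₂ ∧ d₂ ≤ 6))
    (hsum : d₁ + d₂ ≤ 10) (he : e ≤ 8) (h6 : 6 ≤ d₁ ∨ 6 ≤ d₂ → e ≤ 7) : 1 ≤ ntpIncome 10 6 d₁ d₂ e 0 := by
  rcases h₁ with rfl | ⟨h5, h6'⟩
  · rcases h₂ with rfl | ⟨h5', h6''⟩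
    · exact le_trans one_le_ntpIncome_ten_zero_eight (ntpIncome_anti_e he le_rfl)
    · interval_cases d₂
      · rw [ntpIncome_comm]
        exact le_trans one_le_ntpIncome_ten_five_eight (ntpIncome_anti_e he le_rfl)
      · rw [ntpIncome_comm]
        exact le_trans one_le_ntpIncome_ten_six_seven (ntpIncome_anti_e (h6 (Or.inr le_rfl)) le_rfl)
  · rcases h₂ with rfl | ⟨h5', h6''⟩
    · interval_cases d₁
      · exact le_trans one_le_ntpIncome_ten_five_eight (ntpIncome_anti_e he le_rfl)
      · exact le_trans one_le_ntpIncome_ten_six_seven (ntpIncome_anti_e (h6 (Or.inl le_rfl)) le_rfl)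
    · interval_cases d₁ <;> interval_cases d₂
      · exact le_trans one_le_ntpIncome_ten_five_five_eight (ntpIncome_anti_e he le_rfl)
      all_goals omega

/-- **`N = 10`, the non-three-planar case**: every basis line with `≤ 6` points of `W` and every line through a basis
point with `≤ 8` ⇒ the basis pair is fair. -/
theorem basis_pair_fair_ntp_ten (hG : G ∈ flatsQ M (5 + 1)) (hd : (gr M \ G).card = 2)
    (hk : kColoops M G = 1) (hs : ∀ e ∈ gr M, ∀ f ∈ gr M, e ≠ f → rkN M {e, f} = 2)
    (hl : ∀ e ∈ gr M, M.Indep {e}) (hnf : fatClosures M 5 G 2 = ∅)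
    (hntp : ¬ (∃ R ⊆ G \ coloops M G, rkN M R = 2 ∧ ∃ c ∈ G \ coloops M G, ∃ d ∈ G \ coloops M G,
      ∃ e ∈ G \ coloops M G, G \ coloops M G ⊆ clF M (insert c R) ∪ clF M (insert d R) ∪ clF M (insert e R)))
    {B : Finset α} (hB : B ∈ thinMembers M 5 G) (hnP : ¬ bigP M G B) {z : α} (hz : z ∈ G \ clF M B)
    (hl0 : loss M 5 G B z ≠ 0) (hW : (G \ insert z B).card = 10)
    (h2 : ∀ a ∈ insert z B \ coloops M G, ∀ b ∈ insert z B \ coloops M G, a ≠ b →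
      ((G \ insert z B) ∩ clF M {a, b}).card ≤ 6)
    (h1 : ∀ a ∈ insert z B \ coloops M G, ∀ y ∈ G \ insert z B, ((G \ insert z B) ∩ clF M {a, y}).card ≤ 8) :
    loss M 5 G B z ≤ rhoL M 5 G B z * lossIncomeH M 5 G (bigP M G) (dshGT2 M 5 G) B z := by
  obtain ⟨ℓ₁, ℓ₂, C₁, C₂, hℓ₁, hℓ₂, hB2, hB1, ho₁, ho₂, hℓℓ, hc₁, hc₂, hcc, hℓc⟩ :=
    ntp_structure hG hd hk hs hl hB hnP hz (s := 6) (by norm_num) (by omega) (by omega)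
  -- sizes
  have hd₁ : ℓ₁.card = 0 ∨ (5 ≤ ℓ₁.card ∧ ℓ₁.card ≤ 6) := by
    rcases ho₁ with rfl | ⟨h5, a, ha, b, hb, hab, rfl⟩
    · exact Or.inl Finset.card_empty
    · exact Or.inr ⟨h5, h2 a ha b hb hab⟩
  have hd₂ : ℓ₂.card = 0 ∨ (5 ≤ ℓ₂.card ∧ ℓ₂.card ≤ 6) := by
    rcases ho₂ with rfl | ⟨h5, a, ha, b, hb, hab, rfl⟩
    · exact Or.inl Finset.card_empty
    · exact Or.inr ⟨h5, h2 a ha b hb hab⟩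
  have he₁ : C₁.card = 0 ∨ (6 ≤ C₁.card ∧ C₁.card ≤ 8) := by
    rcases hc₁ with rfl | ⟨h6, a, ha, y, hy, rfl⟩
    · exact Or.inl Finset.card_empty
    · exact Or.inr ⟨h6, h1 a ha y hy⟩
  have he₂ : C₂.card = 0 ∨ (6 ≤ C₂.card ∧ C₂.card ≤ 8) := by
    rcases hc₂ with rfl | ⟨h6, a, ha, y, hy, rfl⟩
    · exact Or.inl Finset.card_empty
    · exact Or.inr ⟨h6, h1 a ha y hy⟩
  have hC₁W : C₁ ⊆ G \ insert z B := by
    rcases hc₁ with rfl | ⟨-, a, -, y, -, rfl⟩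
    · exact Finset.empty_subset _
    · exact Finset.inter_subset_left
  have hC₂W : C₂ ⊆ G \ insert z B := by
    rcases hc₂ with rfl | ⟨-, a, -, y, -, rfl⟩
    · exact Finset.empty_subset _
    · exact Finset.inter_subset_left
  -- two long classes cannot coexist: reduce to one class `C` (possibly empty) covering everything
  have hone : ∃ C : Finset α, C ⊆ G \ insert z B ∧ (C.card = 0 ∨ (6 ≤ C.card ∧ C.card ≤ 8)) ∧
      (∀ a ∈ insert z B \ coloops M G, ∀ y ∈ G \ insert z B,
        (G \ insert z B) ∩ clF M {a, y} ⊆ C ∨ ((G \ insert z B) ∩ clF M {a, y}).card + 1 ≤ 6) ∧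
      (∀ ℓ : Finset α, (ℓ = ℓ₁ ∨ ℓ = ℓ₂) → ℓ = C ∨ (ℓ ∩ C).card ≤ 1) := by
    rcases hcc with heq | hint
    · refine ⟨C₁, hC₁W, he₁, ?_, fun ℓ hℓ => hℓc ℓ C₁ hℓ (Or.inl rfl)⟩
      intro a ha y hy
      rcases hB1 a ha y hy with h | h | h
      · exact Or.inl h
      · exact Or.inl (heq ▸ h)
      · exact Or.inr h
    · -- disjoint-ish long classes: one of them is empty
      have hone' : C₁.card = 0 ∨ C₂.card = 0 := by
        by_contra hno
        push Not at hno
        have hA := Finset.card_union_add_card_inter C₁ C₂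
        have hU := Finset.card_le_card (Finset.union_subset hC₁W hC₂W)
        rcases he₁ with h | h
        · exact hno.1 h
        rcases he₂ with h' | h'
        · exact hno.2 h'
        omega
      rcases hone' with h0 | h0
      · refine ⟨C₂, hC₂W, he₂, ?_, fun ℓ hℓ => hℓc ℓ C₂ hℓ (Or.inr rfl)⟩
        intro a ha y hy
        rcases hB1 a ha y hy with h | h | h
        · -- inside the empty `C₁`: the class is empty
          right
          rw [Finset.card_eq_zero] at h0
          rw [h0, Finset.subset_empty] at h
          rw [h, Finset.card_empty]
          norm_num
        · exact Or.inl h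
        · exact Or.inr h
      · refine ⟨C₁, hC₁W, he₁, ?_, fun ℓ hℓ => hℓc ℓ C₁ hℓ (Or.inl rfl)⟩
        intro a ha y hy
        rcases hB1 a ha y hy with h | h | h
        · exact Or.inl h
        · right
          rw [Finset.card_eq_zero] at h0
          rw [h0, Finset.subset_empty] at h
          rw [h, Finset.card_empty]
          norm_num
        · exact Or.inr h
  obtain ⟨C, hCW, heC, hB1', hℓC⟩ := hone
  -- the joint constraint: a `6`-line and a class of `≥ 7` points cannot coexist
  have hjoint : ∀ ℓ : Finset α, (ℓ = ℓ₁ ∨ ℓ = ℓ₂) → ℓ ⊆ G \ insert z B → 6 ≤ ℓ.card → C.card ≤ 7 := by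
    intro ℓ hℓ hℓW h6
    rcases hℓC ℓ hℓ with heq | hint
    · rw [← heq]
      rcases hℓ with rfl | rfl
      · rcases hd₁ with h | h <;> omega
      · rcases hd₂ with h | h <;> omega
    · have hA := Finset.card_union_add_card_inter ℓ C
      have hU := Finset.card_le_card (Finset.union_subset hℓW hCW)
      omega
  -- the two basis lines: equal (then drop one) or disjoint
  rcases hℓℓ with heq | hdisj
  · -- use `(ℓ₁, ∅)`
    have hB2' : ∀ a ∈ insert z B \ coloops M G, ∀ b ∈ insert z B \ coloops M G, a ≠ b →
        (G \ insert z B) ∩ clF M {a, b} ⊆ ℓ₁ ∨ (G \ insert z B) ∩ clF M {a, b} ⊆ (∅ : Finset α) ∨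
          ((G \ insert z B) ∩ clF M {a, b}).card + 2 ≤ 6 := by
      intro a ha b hb hab
      rcases hB2 a ha b hb hab with h | h | h
      · exact Or.inl h
      · exact Or.inl (heq ▸ h)
      · exact Or.inr (Or.inr h)
    apply basis_pair_fair_of_ntp_of_not_threePlanar hG hd hk hs hl hnf hntp hB hnP hz hl0 (by norm_num : 1 ≤ 6) hℓ₁
      (Finset.empty_subset _) hB2' (C₁ := C) (C₂ := ∅) (fun a ha y hy => by
        rcases hB1' a ha y hy with h | h
        · exact Or.inl h
        · exact Or.inr (Or.inr h))
    rw [Finset.card_empty, hW]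
    apply one_le_ntpIncome_ten_of ℓ₁.card 0 C.card hd₁ (Or.inl rfl) (by rcases hd₁ with h | h <;> omega)
      (by rcases heC with h | h <;> omega)
    intro h6
    rcases h6 with h6 | h6
    · exact hjoint ℓ₁ (Or.inl rfl) hℓ₁ h6
    · omega
  · apply basis_pair_fair_of_ntp_of_not_threePlanar hG hd hk hs hl hnf hntp hB hnP hz hl0 (by norm_num : 1 ≤ 6) hℓ₁ hℓ₂ hB2
      (C₁ := C) (C₂ := ∅) (fun a ha y hy => by
        rcases hB1' a ha y hy with h | h
        · exact Or.inl h
        · exact Or.inr (Or.inr h))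
    rw [Finset.card_empty, hW]
    have hsum : ℓ₁.card + ℓ₂.card ≤ 10 := by
      have hA := Finset.card_union_add_card_inter ℓ₁ ℓ₂
      have hU := Finset.card_le_card (Finset.union_subset hℓ₁ hℓ₂)
      omega
    apply one_le_ntpIncome_ten_of ℓ₁.card ℓ₂.card C.card hd₁ hd₂ hsum (by rcases heC with h | h <;> omega)
    intro h6
    rcases h6 with h6 | h6
    · exact hjoint ℓ₁ (Or.inl rfl) hℓ₁ h6
    · exact hjoint ℓ₂ (Or.inr rfl) hℓ₂ h6

/-- The arithmetic of the `N = 9` cells. -/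
theorem one_le_ntpIncome_nine_of (d₁ d₂ e₁ e₂ : ℕ) (h₁ : d₁ = 0 ∨ d₁ = 4) (h₂ : d₂ = 0 ∨ d₂ = 4)
    (he₁ : e₁ ≤ 6) (he₂ : e₂ ≤ 6) : 1 ≤ ntpIncome 9 5 d₁ d₂ e₁ e₂ := by
  rcases h₁ with rfl | rfl <;> rcases h₂ with rfl | rfl
  · exact le_trans one_le_ntpIncome_nine_zero_six (ntpIncome_anti_e he₁ he₂)
  · rw [ntpIncome_comm]
    exact le_trans one_le_ntpIncome_nine_four_six (ntpIncome_anti_e he₁ he₂)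
  · exact le_trans one_le_ntpIncome_nine_four_six (ntpIncome_anti_e he₁ he₂)
  · exact le_trans one_le_ntpIncome_nine_four_four_six (ntpIncome_anti_e he₁ he₂)

/-- **`N = 9`, the non-three-planar case**: every basis line with `≤ 4` points of `W` and every line through a basis
point with `≤ 6` ⇒ the basis pair is fair. -/
theorem basis_pair_fair_ntp_nine (hG : G ∈ flatsQ M (5 + 1)) (hd : (gr M \ G).card = 2)
    (hk : kColoops M G = 1) (hs : ∀ e ∈ gr M, ∀ f ∈ gr M, e ≠ f → rkN M {e, f} = 2)
    (hl : ∀ e ∈ gr M, M.Indep {e}) (hnf : fatClosures M 5 G 2 = ∅)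
    (hntp : ¬ (∃ R ⊆ G \ coloops M G, rkN M R = 2 ∧ ∃ c ∈ G \ coloops M G, ∃ d ∈ G \ coloops M G,
      ∃ e ∈ G \ coloops M G, G \ coloops M G ⊆ clF M (insert c R) ∪ clF M (insert d R) ∪ clF M (insert e R)))
    {B : Finset α} (hB : B ∈ thinMembers M 5 G) (hnP : ¬ bigP M G B) {z : α} (hz : z ∈ G \ clF M B)
    (hl0 : loss M 5 G B z ≠ 0) (hW : (G \ insert z B).card = 9)
    (h2 : ∀ a ∈ insert z B \ coloops M G, ∀ b ∈ insert z B \ coloops M G, a ≠ b →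
      ((G \ insert z B) ∩ clF M {a, b}).card ≤ 4)
    (h1 : ∀ a ∈ insert z B \ coloops M G, ∀ y ∈ G \ insert z B, ((G \ insert z B) ∩ clF M {a, y}).card ≤ 6) :
    loss M 5 G B z ≤ rhoL M 5 G B z * lossIncomeH M 5 G (bigP M G) (dshGT2 M 5 G) B z := by
  obtain ⟨ℓ₁, ℓ₂, C₁, C₂, hℓ₁, hℓ₂, hB2, hB1, ho₁, ho₂, -, hc₁, hc₂, -, -⟩ :=
    ntp_structure hG hd hk hs hl hB hnP hz (s := 5) (by norm_num) (by omega) (by omega)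
  have hd₁ : ℓ₁.card = 0 ∨ ℓ₁.card = 4 := by
    rcases ho₁ with rfl | ⟨h4, a, ha, b, hb, hab, rfl⟩
    · exact Or.inl Finset.card_empty
    · exact Or.inr (by have := h2 a ha b hb hab; omega)
  have hd₂ : ℓ₂.card = 0 ∨ ℓ₂.card = 4 := by
    rcases ho₂ with rfl | ⟨h4, a, ha, b, hb, hab, rfl⟩
    · exact Or.inl Finset.card_empty
    · exact Or.inr (by have := h2 a ha b hb hab; omega)
  have he₁ : C₁.card ≤ 6 := by
    rcases hc₁ with rfl | ⟨-, a, ha, y, hy, rfl⟩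
    · rw [Finset.card_empty]; norm_num
    · exact h1 a ha y hy
  have he₂ : C₂.card ≤ 6 := by
    rcases hc₂ with rfl | ⟨-, a, ha, y, hy, rfl⟩
    · rw [Finset.card_empty]; norm_num
    · exact h1 a ha y hy
  apply basis_pair_fair_of_ntp_of_not_threePlanar hG hd hk hs hl hnf hntp hB hnP hz hl0 (by norm_num : 1 ≤ 5) hℓ₁ hℓ₂ hB2 hB1
  rw [hW]
  exact one_le_ntpIncome_nine_of _ _ _ _ hd₁ hd₂ he₁ he₂

/-- **`N = 8`, the non-three-planar case**: every basis line with `≤ 3` points of `W` and every line through a basis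
point with `≤ 6` ⇒ the basis pair is fair. -/
theorem basis_pair_fair_ntp_eight (hG : G ∈ flatsQ M (5 + 1)) (hd : (gr M \ G).card = 2)
    (hk : kColoops M G = 1) (hs : ∀ e ∈ gr M, ∀ f ∈ gr M, e ≠ f → rkN M {e, f} = 2)
    (hl : ∀ e ∈ gr M, M.Indep {e}) (hnf : fatClosures M 5 G 2 = ∅)
    (hntp : ¬ (∃ R ⊆ G \ coloops M G, rkN M R = 2 ∧ ∃ c ∈ G \ coloops M G, ∃ d ∈ G \ coloops M G,
      ∃ e ∈ G \ coloops M G, G \ coloops M G ⊆ clF M (insert c R) ∪ clF M (insert d R) ∪ clF M (insert e R)))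
    {B : Finset α} (hB : B ∈ thinMembers M 5 G) (hnP : ¬ bigP M G B) {z : α} (hz : z ∈ G \ clF M B)
    (hl0 : loss M 5 G B z ≠ 0) (hW : (G \ insert z B).card = 8)
    (h2 : ∀ a ∈ insert z B \ coloops M G, ∀ b ∈ insert z B \ coloops M G, a ≠ b →
      ((G \ insert z B) ∩ clF M {a, b}).card ≤ 3)
    (h1 : ∀ a ∈ insert z B \ coloops M G, ∀ y ∈ G \ insert z B, ((G \ insert z B) ∩ clF M {a, y}).card ≤ 6) :
    loss M 5 G B z ≤ rhoL M 5 G B z * lossIncomeH M 5 G (bigP M G) (dshGT2 M 5 G) B z := by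
  obtain ⟨ℓ₁, ℓ₂, C₁, C₂, hℓ₁, hℓ₂, hB2, hB1, ho₁, ho₂, -, hc₁, hc₂, hcc, -⟩ :=
    ntp_structure hG hd hk hs hl hB hnP hz (s := 5) (by norm_num) (by omega) (by omega)
  have hd₁ : ℓ₁.card = 0 := by
    rcases ho₁ with rfl | ⟨h4, a, ha, b, hb, hab, rfl⟩
    · exact Finset.card_empty
    · have := h2 a ha b hb hab; omega
  have hd₂ : ℓ₂.card = 0 := by
    rcases ho₂ with rfl | ⟨h4, a, ha, b, hb, hab, rfl⟩
    · exact Finset.card_empty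
    · have := h2 a ha b hb hab; omega
  have he₁ : C₁.card = 0 ∨ (5 ≤ C₁.card ∧ C₁.card ≤ 6) := by
    rcases hc₁ with rfl | ⟨h5, a, ha, y, hy, rfl⟩
    · exact Or.inl Finset.card_empty
    · exact Or.inr ⟨h5, h1 a ha y hy⟩
  have he₂ : C₂.card = 0 ∨ (5 ≤ C₂.card ∧ C₂.card ≤ 6) := by
    rcases hc₂ with rfl | ⟨h5, a, ha, y, hy, rfl⟩
    · exact Or.inl Finset.card_empty
    · exact Or.inr ⟨h5, h1 a ha y hy⟩
  have hC₁W : C₁ ⊆ G \ insert z B := by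
    rcases hc₁ with rfl | ⟨-, a, -, y, -, rfl⟩
    · exact Finset.empty_subset _
    · exact Finset.inter_subset_left
  have hC₂W : C₂ ⊆ G \ insert z B := by
    rcases hc₂ with rfl | ⟨-, a, -, y, -, rfl⟩
    · exact Finset.empty_subset _
    · exact Finset.inter_subset_left
  -- two long classes cannot coexist in eight points
  have hone : ∃ C : Finset α, C.card ≤ 6 ∧
      ∀ a ∈ insert z B \ coloops M G, ∀ y ∈ G \ insert z B,
        (G \ insert z B) ∩ clF M {a, y} ⊆ C ∨ ((G \ insert z B) ∩ clF M {a, y}).card + 1 ≤ 5 := by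
    rcases hcc with heq | hint
    · refine ⟨C₁, by rcases he₁ with h | h <;> omega, ?_⟩
      intro a ha y hy
      rcases hB1 a ha y hy with h | h | h
      · exact Or.inl h
      · exact Or.inl (heq ▸ h)
      · exact Or.inr h
    · have hone' : C₁.card = 0 ∨ C₂.card = 0 := by
        by_contra hno
        push Not at hno
        have hA := Finset.card_union_add_card_inter C₁ C₂
        have hU := Finset.card_le_card (Finset.union_subset hC₁W hC₂W)
        rcases he₁ with h | h
        · exact hno.1 h
        rcases he₂ with h' | h'
        · exact hno.2 h'
        omega
      rcases hone' with h0 | h0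
      · refine ⟨C₂, by rcases he₂ with h | h <;> omega, ?_⟩
        intro a ha y hy
        rcases hB1 a ha y hy with h | h | h
        · right
          rw [Finset.card_eq_zero] at h0
          rw [h0, Finset.subset_empty] at h
          rw [h, Finset.card_empty]
          norm_num
        · exact Or.inl h
        · exact Or.inr h
      · refine ⟨C₁, by rcases he₁ with h | h <;> omega, ?_⟩
        intro a ha y hy
        rcases hB1 a ha y hy with h | h | h
        · exact Or.inl h
        · right
          rw [Finset.card_eq_zero] at h0
          rw [h0, Finset.subset_empty] at h
          rw [h, Finset.card_empty]
          norm_num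
        · exact Or.inr h
  obtain ⟨C, hC6, hB1'⟩ := hone
  apply basis_pair_fair_of_ntp_of_not_threePlanar hG hd hk hs hl hnf hntp hB hnP hz hl0 (by norm_num : 1 ≤ 5) hℓ₁ hℓ₂ hB2
    (C₁ := C) (C₂ := ∅) (fun a ha y hy => by
      rcases hB1' a ha y hy with h | h
      · exact Or.inl h
      · exact Or.inr (Or.inr h))
  rw [hW, hd₁, hd₂, Finset.card_empty]
  exact le_trans one_le_ntpIncome_eight_zero_six (ntpIncome_anti_e hC6 le_rfl)

end PercRepro.Shadow
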